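/-
Copyright (c) 2026. All rights reserved.
Released under Apache 2.0 license as described in the file LICENSE.
Authors: abc-iut cell, wave-2 seat abc-iut-L3-t10 (gen 3; row «LD-REPAIR» (B′): the per-level branch
dictionary with covering kernels and good conjugator sets — statements + glue; binder text abc-iut-L3-t11 gen 2).
-/
import Literature.AnabelianGeometry.SemiGraphs.TemperedLevelData
import Literature.AnabelianGeometry.SemiGraphs.TemperedBranchPairProducerGood
import HarnessLib

/-!
# [SemiAnbd] Thm 3.7 (iii): the per-level branch dictionary with covering kernels and good conjugators

Mochizuki, *Semi-graphs of anabelioids*, Publ. RIMS **42** (2006) [MochizukiSemiAnbd2006], Thm 3.7 (iii) pp. 40–41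
with the author's *Comments* (2020), (6)(b) ("converge, in the profinite topology, to some profinite subjoint …
[cf. Remark 2.2.1] … in the profinite fundamental group `π̂₁(G)`"), Remark 2.2.1 p. 24 (images of `Π_v`, `Π_b`
are the stabilisers of the vertex / branch), Definition 2.2 (i) p. 23 (branches over `b` at `v_j` ↔ double
cosets `Π_{v_j}\Π_v/Π_b`).

STATEMENTS + GLUE (cell row «LD-REPAIR» (B′), rulings α5-1/α8-2 of abc-iut-L3-lead; binder text abc-iut-L3-t11
gen 2, pen abc-iut-L3-t10 gen 3). The producer's deliverable for Thm 3.7 (iii), finite `𝔾`, as DATA + single-level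
obligations, in the form that the Galois tower of `B^temp(𝒢)` can instantiate:

* `ProfiniteSemiGraph.GoodLevelDictionary 𝒢 c` — the tree / finite-level data of `FiniteLevelData` (minus (I4′)),
  the structure maps `𝔾_j → 𝔾`, a compact Hausdorff overgroup `ιQ : π₁^temp(𝒢) ↪ Q` acting on the levels through
  `levelAct` (print: `π̂₁(G)`, Prop. 3.6 (iii)), an antitone family of open normal COVERING kernels `M j` meeting
  in `1` (print: `ker (π̂₁(G) → Gal(𝒢_j/𝒢))`; cell booking O-LD-1: the graph-action kernels of the v1
  `LevelDictionary` do not meet in `1`), reference embeddings `ψ_v`, representatives `rep`, and GOOD conjugator sets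
  `good j w ⊆ Q` (print: `{γ | γ · w₀ = w}`, a coset of `Stab_Q(w₀)`), nonempty, closed, decreasing along the
  transitions (cell booking O-LD-2: the branch obligations must not be asked for every conjugator admissible for
  the vertex identity — extra normaliser, abc-iut-L3-t11's dihedral example);
* `GoodLevelDictionary.DB / DI / DN` — (DB′) branch stabilisers `Stab_Q(w, β) = γ·ψ_v(y·Π_b·y⁻¹)·γ⁻¹·M_j` for
  good `γ` (Remark 2.2.1), (DI′) injectivity and (DN′) naturality of the double cosets `M̃_j·y·Π_b`
  (Definition 2.2 (i)); the vertex identity (DV) is not an input of (I4′) and is not a field;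
* `GoodLevelDictionary.toFiniteLevelData (h₂ h₃ h₄)` — the glue to abc-iut-L3-t10's `FiniteLevelData` through
  `stabBranchPair'_of_coveringDictionary'` (`TemperedBranchPairProducerGood.lean`); the consumer
  `compactInVerticial_of_goodLevelDictionary` is in the proof-only sequel.

Typed ≠ proved: the three obligations are stated, not discharged, here. No instances beyond the
structure-bundled ones (as in `LevelDictionary` / `FiniteLevelData`), no notation. Nothing here takes a side on
[IUTchIII] Cor. 3.12.
-/

namespace Literature.AnabelianGeometry.SemiGraphs

namespace ProfiniteSemiGraph

open CategoryTheory Topology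
open scoped Pointwise

universe v u

variable {𝒢 : ProfiniteSemiGraph.{u}}

/-- **The per-level branch dictionary data with covering kernels and good conjugator sets** over a chart `c`
of `π₁^temp(𝒢)`: the
tree-level data (`VerticialLevelData`), the finite levels `𝔾_j` with their graph-coverings, actions and
transitions (as in `FiniteLevelData`), their structure maps to `𝔾`, a compact Hausdorff overgroup
`ιQ : π₁^temp(𝒢) ↪ Q` acting compatibly on the levels (print: the profinite completion `π̂₁(G)`, Prop. 3.6
(iii)), an antitone family of open normal subgroups `M_j ≤ Q` meeting in `1` (print: the kernels
`ker (π̂₁(G) → Gal(𝒢_j/𝒢))` of the finite étale Galois COVERINGS — NOT the kernels of the actions on the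
graphs `𝔾_j`, which need not meet in `1`: for an edgeless one-vertex `𝒢` every `𝔾_j` is a point), reference
embeddings `ψ_v : Π_v → Q`, chosen double-coset representatives `rep`, and the good conjugator sets `good j w`
(nonempty, closed, decreasing). [cite: MochizukiSemiAnbd2006, Rmk. 2.2.1 p.24] -/
structure GoodLevelDictionary (𝒢 : ProfiniteSemiGraph.{u}) (c : TemperedPiChart 𝒢)
    extends VerticialLevelData.{v} 𝒢 c where
  /-- the finite semi-graphs `𝔾_j` underlying the finite étale Galois coverings `𝒢_j → 𝒢` -/
  level : J → SemiGraph.{u}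
  [finiteVertex : ∀ j, Finite (level j).Vertex]
  [finiteBranch : ∀ j, Finite (level j).Branch]
  /-- the universal graph-coverings `𝒢_{∞,j} → 𝔾_j` -/
  quot : ∀ j, tree j ⟶ level j
  /-- graph-coverings are immersions -/
  quot_isImmersion : ∀ j, SemiGraph.IsImmersion (quot j)
  /-- the induced actions on the finite levels -/
  levelAct : ∀ j, c.G →* Aut (level j)
  /-- `quot` is equivariant -/
  act_quot : ∀ (j : J) (g : c.G), (act j g).hom ≫ quot j = quot j ≫ (levelAct j g).hom
  /-- the transition morphisms `𝔾_j → 𝔾_i`, `i ≤ j` -/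
  levelTrans : ∀ ⦃i j : J⦄, i ≤ j → (level j ⟶ level i)
  /-- functoriality: identities -/
  levelTrans_id : ∀ j, levelTrans (le_refl j) = 𝟙 (level j)
  /-- functoriality: composition -/
  levelTrans_comp : ∀ ⦃i j k : J⦄ (hij : i ≤ j) (hjk : j ≤ k),
    levelTrans hjk ≫ levelTrans hij = levelTrans (hij.trans hjk)
  /-- the finite-level transition morphisms are equivariant -/
  levelTrans_act : ∀ ⦃i j : J⦄ (h : i ≤ j) (g : c.G),
    (levelAct j g).hom ≫ levelTrans h = levelTrans h ≫ (levelAct i g).hom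
  /-- the transition morphisms of the trees cover those of the finite levels -/
  trans_quot : ∀ ⦃i j : J⦄ (h : i ≤ j), trans h ≫ quot i = quot j ≫ levelTrans h
  /-- the structure maps `𝔾_j → 𝔾` -/
  levelProj : ∀ j, level j ⟶ 𝒢.graph
  /-- the structure maps are compatible with the transitions -/
  levelProj_trans : ∀ ⦃i j : J⦄ (h : i ≤ j), levelTrans h ≫ levelProj i = levelProj j
  /-- the compact overgroup `Q` (print: `π̂₁(G)`) -/
  Q : Type u
  [groupQ : Group Q]
  [topologicalSpaceQ : TopologicalSpace Q]
  [isTopologicalGroupQ : IsTopologicalGroup Q]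
  [compactSpaceQ : CompactSpace Q]
  [t2SpaceQ : T2Space Q]
  /-- `π₁^temp(𝒢) → Q` -/
  ιQ : c.G →* Q
  /-- … is injective (residual finiteness with respect to the finite levels, Prop 3.6 (iii)) -/
  ιQ_injective : Function.Injective ιQ
  /-- the actions of `Q` on the finite levels -/
  qAct : ∀ j, Q →* Aut (level j)
  /-- … extending those of `π₁^temp(𝒢)` -/
  qAct_ιQ : ∀ (j : J) (g : c.G), qAct j (ιQ g) = levelAct j g
  /-- the covering kernels `M_j` (print: `ker (π̂₁(G) → Gal(𝒢_j/𝒢))`, `𝒢_j → 𝒢` the finite étale Galois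
  covering whose underlying semi-graph is `level j`; they are contained in, and in general strictly smaller
  than, the kernels of the actions `qAct j` on the GRAPHS `level j`) -/
  M : J → Subgroup Q
  /-- … normal -/
  M_normal : ∀ j, (M j).Normal
  /-- … open -/
  isOpen_M : ∀ j, IsOpen (M j : Set Q)
  /-- … antitone -/
  M_anti : ∀ ⦃i j : J⦄, i ≤ j → M j ≤ M i
  /-- … and meet in `1` (`Q` is the completion with respect to the coverings `𝒢_j`) -/
  M_trivial : ∀ q : Q, (∀ j, q ∈ M j) → q = 1
  /-- the reference embeddings `ψ_v : Π_v → Q` -/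
  ψ : ∀ v : 𝒢.graph.Vertex, 𝒢.Gv v →* Q
  /-- … injective -/
  ψ_injective : ∀ v, Function.Injective (ψ v)
  /-- … continuous -/
  ψ_continuous : ∀ v, Continuous (ψ v)
  /-- chosen double-coset representatives `y_β ∈ Π_v` of the branches of the finite levels -/
  rep : ∀ (j : J) (_ : (level j).Vertex) (v : 𝒢.graph.Vertex) (_ : Q) (_ : (level j).Branch), 𝒢.Gv v
  /-- the good conjugator sets (print: the `γ` with `γ · w₀ = w`, `w₀` the reference vertex over `v`) -/
  good : ∀ j, (level j).Vertex → Set Q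
  /-- … nonempty -/
  good_nonempty : ∀ (j : J) (w : (level j).Vertex), (good j w).Nonempty
  /-- … closed -/
  good_isClosed : ∀ (j : J) (w : (level j).Vertex), IsClosed (good j w)
  /-- … decreasing along the transition maps -/
  good_anti : ∀ ⦃i j : J⦄ (h : i ≤ j) (w : (level j).Vertex), good j w ⊆ good i ((levelTrans h).vertexMap w)

attribute [instance] GoodLevelDictionary.finiteVertex GoodLevelDictionary.finiteBranch GoodLevelDictionary.groupQ
  GoodLevelDictionary.topologicalSpaceQ GoodLevelDictionary.isTopologicalGroupQ GoodLevelDictionary.compactSpaceQ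
  GoodLevelDictionary.t2SpaceQ

namespace GoodLevelDictionary

variable {c : TemperedPiChart 𝒢} (X : GoodLevelDictionary.{v} 𝒢 c)

/-- **(P2′) = (DB′), branch stabilisers** (Remark 2.2.1 for branches, one finite level): for a GOOD conjugator `γ ∈ good j w`, the `Q`-stabiliser of `(w, β)`, `β` a branch at `w` over `b`, is `γ·ψ_v(y·Π_b·y⁻¹)·γ⁻¹·M_j` with `y = rep j w v γ β`. [cite: MochizukiSemiAnbd2006, Rmk. 2.2.1 p.24] -/
def DB : Prop :=
  ∀ (j : X.J) (w : (X.level j).Vertex) (v : 𝒢.graph.Vertex) (_ : (X.levelProj j).vertexMap w = v) (γ : X.Q),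
      γ ∈ X.good j w →
      ∀ (β : (X.level j).Branch) (_ : (X.level j).abuts β = some w) (b : 𝒢.graph.Branch)
        (_ : (X.levelProj j).branchMap β = b) (hb : 𝒢.graph.abuts b = some v),
        ∀ q : X.Q, ((X.qAct j q).hom.vertexMap w = w ∧ (X.qAct j q).hom.branchMap β = β) ↔
          q ∈ (((𝒢.branchSubgroup b v hb).map (MulAut.conj (X.rep j w v γ β)).toMonoidHom).map (X.ψ v)).map
            (MulAut.conj γ).toMonoidHom ⊔ X.M j

/-- **(P3′) = (DI′), injectivity of the branch dictionary** (Definition 2.2 (i), one finite level; good `γ`): distinct branches at `w` over the same `b` have distinct double cosets `M̃_j·y·Π_b` (`M̃_j` the level inside `Π_v`). [cite: MochizukiSemiAnbd2006, Def. 2.2(i) p.23] -/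
def DI : Prop :=
  ∀ (j : X.J) (w : (X.level j).Vertex) (v : 𝒢.graph.Vertex) (_ : (X.levelProj j).vertexMap w = v) (γ : X.Q),
      γ ∈ X.good j w →
      ∀ (β β' : (X.level j).Branch), (X.level j).abuts β = some w → (X.level j).abuts β' = some w →
        ∀ (b : 𝒢.graph.Branch) (hb : 𝒢.graph.abuts b = some v),
        (X.levelProj j).branchMap β = b → (X.levelProj j).branchMap β' = b → β ≠ β' →
        X.rep j w v γ β' ∉ (((X.M j).comap ((MulAut.conj γ).toMonoidHom.comp (X.ψ v)) : Subgroup (𝒢.Gv v)) :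
          Set (𝒢.Gv v)) * {X.rep j w v γ β} * (𝒢.branchSubgroup b v hb : Set (𝒢.Gv v))

/-- **(P4′) = (DN′), naturality of the branch dictionary** (Definition 2.2 (i) under a transition `𝔾_j → 𝔾_i`; good `γ`, which stays good at level `i` by `good_anti`): the representative of `β` lies in the level-`i` double coset of the image branch. [cite: MochizukiSemiAnbd2006, Def. 2.2(i) p.23] -/
def DN : Prop :=
  ∀ ⦃i j : X.J⦄ (h : i ≤ j) (w : (X.level j).Vertex) (v : 𝒢.graph.Vertex) (_ : (X.levelProj j).vertexMap w = v)
      (γ : X.Q), γ ∈ X.good j w →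
      ∀ (β : (X.level j).Branch), (X.level j).abuts β = some w → ∀ (b : 𝒢.graph.Branch)
        (hb : 𝒢.graph.abuts b = some v), (X.levelProj j).branchMap β = b →
        X.rep j w v γ β ∈ (((X.M i).comap ((MulAut.conj γ).toMonoidHom.comp (X.ψ v)) : Subgroup (𝒢.Gv v)) :
          Set (𝒢.Gv v)) * {X.rep i ((X.levelTrans h).vertexMap w) v γ ((X.levelTrans h).branchMap β)} *
            (𝒢.branchSubgroup b v hb : Set (𝒢.Gv v))

/-- **The glue**: a good level dictionary satisfying the three branch obligations yields abc-iut-L3-t10's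
`FiniteLevelData` — the identification (I4′) `stabBranchPair'` being `stabBranchPair'_of_coveringDictionary'` — and
hence, through `FiniteLevelData`, both conjuncts of `CompactInVerticial` (proof-only sequel).
[cite: MochizukiSemiAnbd2006, Thm 3.7(iii) p.41] -/
noncomputable def toFiniteLevelData (h₂ : X.DB) (h₃ : X.DI) (h₄ : X.DN) :
    FiniteLevelData.{v} 𝒢 c where
  toVerticialLevelData := X.toVerticialLevelData
  level := X.level
  quot := X.quot
  quot_isImmersion := X.quot_isImmersion
  levelAct := X.levelAct
  act_quot := X.act_quot
  levelTrans := X.levelTrans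
  levelTrans_id := X.levelTrans_id
  levelTrans_comp := X.levelTrans_comp
  levelTrans_act := X.levelTrans_act
  trans_quot := X.trans_quot
  stabBranchPair' :=
    stabBranchPair'_of_coveringDictionary' c X.level X.levelAct X.levelTrans X.levelProj X.levelProj_trans X.Q
      X.ιQ X.ιQ_injective X.qAct X.qAct_ιQ X.M X.M_normal X.isOpen_M X.M_anti X.M_trivial X.ψ X.ψ_injective
      X.ψ_continuous X.rep X.good X.good_nonempty X.good_isClosed X.good_anti h₂ h₃ h₄


end GoodLevelDictionary

end ProfiniteSemiGraph

end Literature.AnabelianGeometry.SemiGraphs
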